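import Mathlib
import Literature.Analysis.FluidPDE.LoopCirculation
import Summits.NavierStokesRegularity.NavierStokesRegularity.Theorems.TautLoopKelvinTautLoopLawLevelLeftContinuity
import HarnessLib

/-!
# Route `TautLoopKelvin`, crux `TautLoopLaw` (stmt-NavierStokesRegularity-15249), line
  `Sketch-ideas-r1k1` (Dini–Saks architecture) — tools stub `stub_tautLoopStepSpectrumTools`

Elementary facts about the circulation–length spectrum
`ℓ(v, g) := inf {len γ : γ a closed C¹ loop, g ≤ |∮_γ v · dℓ|} ∈ [0, ∞]` (`len γ = ∫₀¹ ‖γ′‖`) and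
about the near-taut compression rate
`Λ(v, g) := ⨅_{ε > 0} sSup K_ε`, `K_ε := {κ(γ) : γ admissible at level g, len γ ≤ ℓ(v, g) + ε}`,
`κ(γ) := (∫₀¹ −⟪γ′, Dv(γ) γ′⟫ / ‖γ′‖) / len γ`, of a field `v : ℝ³ → ℝ³`, serving the two open
skeleton stubs (random-walk selection and the exact-level step) of the line:

1. **Positivity of the spectrum.** If `‖v‖ ≤ B` (`B > 0`), every loop admissible at level `g` has
   length `≥ g / B` (`g ≤ |∮_γ v| ≤ B · len γ`), so `ℓ(v, g) ≥ g / B`.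
2. **Junk guards on `Λ`.** If `‖Dv‖ ≤ L₁`, then `|κ(γ)| ≤ L₁` for *every* curve `γ`
   (Cauchy–Schwarz; the junk conventions `x / 0 = 0` and `∫ (non-integrable) = 0` are covered), so
   each `K_ε` is bounded above and `sSup K_ε` is a genuine supremum; since moreover
   `⨅ f < ⨅ f + η` produces an index `ε` with `f ε < ⨅ f + η` in a conditionally complete linear
   order (`exists_lt_of_ciInf_lt`, no lower bound needed), for every `η > 0` there is `ε > 0` such
   that every admissible loop of length `≤ ℓ(v, g) + ε` has `κ(γ) ≤ Λ(v, g) + η`.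
3. **Confinement.** If `‖v x‖ ≤ κ₀` for `‖x‖ ≥ R₀` and `κ₀ · L_b < g`, every loop admissible at level
   `g` of length `≤ L_b` visits the open ball of radius `R₀` (else `|∮_γ v| ≤ κ₀ · len γ ≤ κ₀ L_b < g`)
   and has diameter `≤ len γ ≤ L_b`, so it lies in the closed ball of radius `R₀ + L_b`.

All statements are folklore; everything is proved (Mathlib + the loop API of
`Literature.Analysis.FluidPDE.LoopCirculation` + the confinement helpers
`tautLoopLlc_abs_circulation_le`, `tautLoopLlc_norm_sub_base_le`, `tautLoopLlc_len_comp_add_const`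
of the sibling file `…TautLoopLawLevelLeftContinuity`).
-/

noncomputable section

open Set MeasureTheory Filter Topology Function Real intervalIntegral
  Literature.Analysis.FluidPDE
open scoped ENNReal NNReal InnerProductSpace RealInnerProductSpace

namespace Summit.NavierStokesRegularity.NavierStokesRegularity.Theorems

set_option linter.dupNamespace false

local notation3 "E3" => EuclideanSpace ℝ (Fin 3)

/-- The length `∫₀¹ ‖γ′‖` of a curve read on `[0, 1]`. -/
local notation3 "len⟦" γ "⟧" => (∫ σ in (0:ℝ)..1, ‖deriv γ σ‖)

/-- The circulation–length spectrum `ℓ(v, g)`. -/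
local notation3 "ℓ⟦" v ", " g "⟧" => (⨅ (γ' : ℝ → EuclideanSpace ℝ (Fin 3))
  (_ : Literature.Analysis.FluidPDE.IsC1Loop γ' ∧
    g ≤ |Literature.Analysis.FluidPDE.circulation v γ'|),
  ENNReal.ofReal (∫ σ in (0:ℝ)..1, ‖deriv γ' σ‖))

/-- The compression `κ(γ)` of the field `v` along the curve `γ`. -/
local notation3 "κ⟦" v ", " γ "⟧" =>
  ((∫ σ in (0:ℝ)..1, -(inner ℝ (deriv γ σ) (fderiv ℝ v (γ σ) (deriv γ σ))) / ‖deriv γ σ‖) /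
    (∫ σ in (0:ℝ)..1, ‖deriv γ σ‖))

/-- The near-taut compression set `K_ε` at level `g`. -/
local notation3 "K⟦" v ", " g ", " ε "⟧" => {k : ℝ | ∃ γ : ℝ → EuclideanSpace ℝ (Fin 3),
  Literature.Analysis.FluidPDE.IsC1Loop γ ∧ g ≤ |Literature.Analysis.FluidPDE.circulation v γ| ∧
  ENNReal.ofReal (∫ σ in (0:ℝ)..1, ‖deriv γ σ‖) ≤ ℓ⟦v, g⟧ + ENNReal.ofReal (ε : ℝ) ∧
  k = κ⟦v, γ⟧}

/-! ## Part 1: positivity of the spectrum -/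

/-- A loop admissible at level `g` for a field bounded by `B > 0` has length `≥ g / B`:
`g ≤ |∮_γ v| ≤ B · len γ`. [folklore] -/
theorem tautLoopSpec_div_le_len {v : E3 → E3} (hv : Continuous v) {B g : ℝ} (hB : 0 < B)
    (hvB : ∀ x, ‖v x‖ ≤ B) {γ : ℝ → E3} (hγ : IsC1Loop γ) (hg : g ≤ |circulation v γ|) :
    g / B ≤ len⟦γ⟧ := by
  rw [div_le_iff₀ hB]
  have h := tautLoopLlc_abs_circulation_le hv hγ fun s => hvB (γ s)
  linarith

/-- **Positivity of the spectrum.** If `‖v‖ ≤ B` with `B > 0`, then `ℓ(v, g) ≥ g / B` (in `ℝ≥0∞`,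
through `ENNReal.ofReal`). [folklore] -/
theorem tautLoopSpec_ofReal_div_le_spectrum (v : E3 → E3) (B g : ℝ) (hB : 0 < B) (_hg : 0 < g)
    (hv : Continuous v) (hvB : ∀ x, ‖v x‖ ≤ B) : ENNReal.ofReal (g / B) ≤ ℓ⟦v, g⟧ :=
  le_iInf₂ fun _γ hγ => ENNReal.ofReal_le_ofReal (tautLoopSpec_div_le_len hv hB hvB hγ.1 hγ.2)

/-! ## Part 2: junk guards on the near-taut compression rate -/

/-- Two-sided pointwise bound on the compression integrand: if `‖Dv(x)‖ ≤ L` everywhere and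
`0 ≤ L`, then `|−⟪γ′ σ, Dv(γ σ) γ′ σ⟫ / ‖γ′ σ‖| ≤ L ‖γ′ σ‖` for every curve `γ` and parameter `σ`
(Cauchy–Schwarz and the operator-norm bound; `x / 0 = 0` when `γ′ σ = 0`). [folklore] -/
theorem tautLoopSpec_abs_integrand_le {v : E3 → E3} {L : ℝ} (hL : 0 ≤ L)
    (hDv : ∀ x, ‖fderiv ℝ v x‖ ≤ L) (γ : ℝ → E3) (σ : ℝ) :
    |-(inner ℝ (deriv γ σ) (fderiv ℝ v (γ σ) (deriv γ σ))) / ‖deriv γ σ‖| ≤ L * ‖deriv γ σ‖ := by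
  rw [abs_div, abs_neg, abs_norm]
  refine div_le_of_le_mul₀ (norm_nonneg _) (mul_nonneg hL (norm_nonneg _)) ?_
  calc |inner ℝ (deriv γ σ) (fderiv ℝ v (γ σ) (deriv γ σ))|
      ≤ ‖deriv γ σ‖ * ‖fderiv ℝ v (γ σ) (deriv γ σ)‖ := abs_real_inner_le_norm _ _
    _ ≤ ‖deriv γ σ‖ * (L * ‖deriv γ σ‖) := by
        gcongr
        exact (ContinuousLinearMap.le_opNorm _ _).trans
          (mul_le_mul_of_nonneg_right (hDv _) (norm_nonneg _))
    _ = L * ‖deriv γ σ‖ * ‖deriv γ σ‖ := by ring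

/-- **Two-sided bound on the compression.** If `‖Dv‖ ≤ L` everywhere and `0 ≤ L`, then
`|κ(γ)| ≤ L` for every curve `γ : ℝ → ℝ³` (length `0`, or a non-integrable integrand, gives the
junk value `0`). [folklore] -/
theorem tautLoopSpec_abs_compression_le {v : E3 → E3} {L : ℝ} (hL : 0 ≤ L)
    (hDv : ∀ x, ‖fderiv ℝ v x‖ ≤ L) (γ : ℝ → E3) : |κ⟦v, γ⟧| ≤ L := by
  have hℓ : 0 ≤ len⟦γ⟧ := intervalIntegral.integral_nonneg zero_le_one fun σ _ => norm_nonneg _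
  rcases hℓ.eq_or_lt with h0 | hpos
  · rw [← h0, div_zero, abs_zero]
    exact hL
  · rw [abs_div, abs_of_pos hpos, div_le_iff₀ hpos]
    have hg : IntervalIntegrable (fun σ => ‖deriv γ σ‖) volume 0 1 := by
      by_contra h
      exact hpos.ne' (intervalIntegral.integral_undef h)
    calc |∫ σ in (0:ℝ)..1, -(inner ℝ (deriv γ σ) (fderiv ℝ v (γ σ) (deriv γ σ))) / ‖deriv γ σ‖|
        ≤ ∫ σ in (0:ℝ)..1, L * ‖deriv γ σ‖ := by
          rw [← Real.norm_eq_abs]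
          exact intervalIntegral.norm_integral_le_of_norm_le zero_le_one
            (Eventually.of_forall fun σ _ => by
              rw [Real.norm_eq_abs]
              exact tautLoopSpec_abs_integrand_le hL hDv γ σ)
            (hg.const_mul L)
      _ = L * len⟦γ⟧ := intervalIntegral.integral_const_mul L _

/-- The near-taut compression set `K_ε` is bounded above (by the gradient bound). [folklore] -/
theorem tautLoopSpec_bddAbove {v : E3 → E3} {L : ℝ} (hL : 0 ≤ L) (hDv : ∀ x, ‖fderiv ℝ v x‖ ≤ L)
    (g ε : ℝ) : BddAbove K⟦v, g, ε⟧ := by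
  refine ⟨L, ?_⟩
  rintro k ⟨γ, -, -, -, rfl⟩
  exact (abs_le.1 (tautLoopSpec_abs_compression_le hL hDv γ)).2

/-- The near-taut compression set `K_ε` is bounded below (by minus the gradient bound). [folklore] -/
theorem tautLoopSpec_bddBelow {v : E3 → E3} {L : ℝ} (hL : 0 ≤ L) (hDv : ∀ x, ‖fderiv ℝ v x‖ ≤ L)
    (g ε : ℝ) : BddBelow K⟦v, g, ε⟧ := by
  refine ⟨-L, ?_⟩
  rintro k ⟨γ, -, -, -, rfl⟩
  exact (abs_le.1 (tautLoopSpec_abs_compression_le hL hDv γ)).1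

/-- **Junk guards on `Λ`: extraction of near-taut loops.** If `‖Dv‖ ≤ L₁`, then for every `η > 0`
there is `ε > 0` such that every loop `γ` admissible at level `g` with `len γ ≤ ℓ(v, g) + ε` has
compression `κ(γ) ≤ Λ(v, g) + η`: `K_ε` is bounded above by `L₁`, so `κ(γ) ≤ sSup K_ε`, and
`exists_lt_of_ciInf_lt` extracts `ε` with `sSup K_ε < Λ + η`. [folklore] -/
theorem tautLoopSpec_extraction (v : E3 → E3) (L₁ g : ℝ) (hL₁ : 0 ≤ L₁) (_hg : 0 < g)
    (_hv : ContDiff ℝ 1 v) (hDv : ∀ x, ‖fderiv ℝ v x‖ ≤ L₁)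
    (_hne : ∃ γ : ℝ → E3, IsC1Loop γ ∧ g ≤ |circulation v γ|) (η : ℝ) (hη : 0 < η) :
    ∃ ε : ℝ, 0 < ε ∧ ∀ γ : ℝ → E3, IsC1Loop γ → g ≤ |circulation v γ| →
      ENNReal.ofReal len⟦γ⟧ ≤ ℓ⟦v, g⟧ + ENNReal.ofReal ε →
        κ⟦v, γ⟧ ≤ (⨅ ε : {ε : ℝ // 0 < ε}, sSup K⟦v, g, ε⟧) + η := by
  haveI : Nonempty {ε : ℝ // 0 < ε} := ⟨⟨1, one_pos⟩⟩
  obtain ⟨ε, hε⟩ := exists_lt_of_ciInf_lt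
    (lt_add_of_pos_right (⨅ ε : {ε : ℝ // 0 < ε}, sSup K⟦v, g, ε⟧) hη)
  refine ⟨ε, ε.2, fun γ hγ hcirc hlenγ => ?_⟩
  exact hε.le.trans' (le_csSup (tautLoopSpec_bddAbove hL₁ hDv g ε) ⟨γ, hγ, hcirc, hlenγ, rfl⟩)

/-! ## Part 3: confinement of near-taut loops -/

/-- **Confinement.** If `‖v x‖ ≤ κ₀` whenever `‖x‖ ≥ R₀` and `κ₀ · L_b < g`, then every closed `C¹`
loop `γ` with `g ≤ |∮_γ v|` and `len γ ≤ L_b` lies in the closed ball of radius `R₀ + L_b`: some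
point of the loop has `‖γ σ₀‖ < R₀` (else `|∮_γ v| ≤ κ₀ · len γ ≤ κ₀ L_b < g`), and every other
point is within `len γ ≤ L_b` of it. [folklore] -/
theorem tautLoopSpec_confinement {v : E3 → E3} (hv : Continuous v) {κ₀ R₀ Lb g : ℝ}
    (hfar : ∀ x, R₀ ≤ ‖x‖ → ‖v x‖ ≤ κ₀) (hgap : κ₀ * Lb < g) {γ : ℝ → E3} (hγ : IsC1Loop γ)
    (hcirc : g ≤ |circulation v γ|) (hlen : len⟦γ⟧ ≤ Lb) (σ : ℝ) : ‖γ σ‖ ≤ R₀ + Lb := by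
  -- some point of the loop lies in the open ball of radius `R₀`
  obtain ⟨σ₀, hσ₀⟩ : ∃ σ₀, ‖γ σ₀‖ < R₀ := by
    by_contra h
    have hout : ∀ s, R₀ ≤ ‖γ s‖ := fun s => not_lt.1 fun hs => h ⟨s, hs⟩
    have hsmall : ∀ s, ‖v (γ s)‖ ≤ κ₀ := fun s => hfar _ (hout s)
    have hκ₀ : 0 ≤ κ₀ := (norm_nonneg _).trans (hsmall 0)
    have h1 := tautLoopLlc_abs_circulation_le hv hγ hsmall
    have h2 : κ₀ * len⟦γ⟧ ≤ κ₀ * Lb := mul_le_mul_of_nonneg_left hlen hκ₀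
    linarith
  -- every other point is within `len γ ≤ Lb` of it
  have hdiam : ‖γ σ - γ σ₀‖ ≤ len⟦γ⟧ := by
    have h := tautLoopLlc_norm_sub_base_le (hγ.comp_add_const σ₀) (σ - σ₀)
    simp only [sub_add_cancel, zero_add] at h
    rwa [tautLoopLlc_len_comp_add_const hγ.periodic σ₀] at h
  have := norm_le_norm_add_norm_sub' (γ σ) (γ σ₀)
  linarith

/-! ## The tools stub -/

/-- **Tools stub `stub_tautLoopStepSpectrumTools`** (registered; serves the random-walk selection
and the exact-level step of line `Sketch-ideas-r1k1`): the conjunction of (1) positivity of the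
circulation–length spectrum `ℓ(v, g) ≥ g / ‖v‖∞`, (2) the junk guards on the literal near-taut
compression rate `Λ(v, g)` under a gradient bound (near-taut loops have compression `≤ Λ + η`),
(3) confinement of admissible loops of bounded length when the field is small outside a ball,
with all binders explicit. [folklore] -/
theorem stub_tautLoopStepSpectrumTools : (∀ (v : EuclideanSpace ℝ (Fin 3) → EuclideanSpace ℝ
    (Fin 3)) (B g : ℝ), 0 < B → 0 < g → Continuous v → (∀ x, ‖v x‖ ≤ B) → ENNReal.ofReal (g / B)
    ≤ (⨅ (γ' : ℝ → EuclideanSpace ℝ (Fin 3)) (_ : Literature.Analysis.FluidPDE.IsC1Loop γ' ∧ g ≤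
    |Literature.Analysis.FluidPDE.circulation v γ'|), ENNReal.ofReal (∫ σ in (0:ℝ)..1, ‖deriv γ'
    σ‖))) ∧ (∀ (v : EuclideanSpace ℝ (Fin 3) → EuclideanSpace ℝ (Fin 3)) (L₁ g : ℝ), 0 ≤ L₁ → 0
    < g → ContDiff ℝ 1 v → (∀ x, ‖fderiv ℝ v x‖ ≤ L₁) → (∃ γ : ℝ → EuclideanSpace ℝ (Fin 3),
    Literature.Analysis.FluidPDE.IsC1Loop γ ∧ g ≤ |Literature.Analysis.FluidPDE.circulation v γ|)
    → ∀ η : ℝ, 0 < η → ∃ ε : ℝ, 0 < ε ∧ ∀ γ : ℝ → EuclideanSpace ℝ (Fin 3),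
    Literature.Analysis.FluidPDE.IsC1Loop γ → g ≤ |Literature.Analysis.FluidPDE.circulation v γ|
    → ENNReal.ofReal (∫ σ in (0:ℝ)..1, ‖deriv γ σ‖) ≤ (⨅ (γ' : ℝ → EuclideanSpace ℝ (Fin 3)) (_
    : Literature.Analysis.FluidPDE.IsC1Loop γ' ∧ g ≤ |Literature.Analysis.FluidPDE.circulation v
    γ'|), ENNReal.ofReal (∫ σ in (0:ℝ)..1, ‖deriv γ' σ‖)) + ENNReal.ofReal ε → ((∫ σ in
    (0:ℝ)..1, -(inner ℝ (deriv γ σ) (fderiv ℝ v (γ σ) (deriv γ σ))) / ‖deriv γ σ‖) / (∫ σ in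
    (0:ℝ)..1, ‖deriv γ σ‖)) ≤ (⨅ ε : {ε : ℝ // 0 < ε}, sSup {k : ℝ | ∃ γ : ℝ → EuclideanSpace ℝ
    (Fin 3), Literature.Analysis.FluidPDE.IsC1Loop γ ∧ g ≤
    |Literature.Analysis.FluidPDE.circulation v γ| ∧ ENNReal.ofReal (∫ σ in (0:ℝ)..1, ‖deriv γ
    σ‖) ≤ (⨅ (γ' : ℝ → EuclideanSpace ℝ (Fin 3)) (_ : Literature.Analysis.FluidPDE.IsC1Loop γ' ∧
    g ≤ |Literature.Analysis.FluidPDE.circulation v γ'|), ENNReal.ofReal (∫ σ in (0:ℝ)..1,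
    ‖deriv γ' σ‖)) + ENNReal.ofReal (ε : ℝ) ∧ k = ((∫ σ in (0:ℝ)..1, -(inner ℝ (deriv γ σ)
    (fderiv ℝ v (γ σ) (deriv γ σ))) / ‖deriv γ σ‖) / (∫ σ in (0:ℝ)..1, ‖deriv γ σ‖))}) + η) ∧
    (∀ (v : EuclideanSpace ℝ (Fin 3) → EuclideanSpace ℝ (Fin 3)) (κ₀ R₀ Lb g : ℝ), Continuous v
    → (∀ x, R₀ ≤ ‖x‖ → ‖v x‖ ≤ κ₀) → κ₀ * Lb < g → ∀ γ : ℝ → EuclideanSpace ℝ (Fin 3),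
    Literature.Analysis.FluidPDE.IsC1Loop γ → g ≤ |Literature.Analysis.FluidPDE.circulation v γ|
    → (∫ σ in (0:ℝ)..1, ‖deriv γ σ‖) ≤ Lb → ∀ σ, ‖γ σ‖ ≤ R₀ + Lb) :=
  ⟨tautLoopSpec_ofReal_div_le_spectrum, tautLoopSpec_extraction,
    fun _v _κ₀ _R₀ _Lb _g hv hfar hgap _γ hγ hcirc hlen σ =>
      tautLoopSpec_confinement hv hfar hgap hγ hcirc hlen σ⟩

end Summit.NavierStokesRegularity.NavierStokesRegularity.Theorems

end
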